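import Summits.ResolutionOfSingularities.ResolutionOfSingularities.Theorems.WeightedInvariantWeightedThesisHypersurfaceModelProjection
import Literature.AlgebraicGeometry.Motives.CyclesGraphClosure
import Literature.AlgebraicGeometry.Motives.ProjectiveLineInvolution
import Literature.AlgebraicGeometry.Motives.ProjectiveSpaceFunctionField
import Literature.AlgebraicGeometry.Resolution.ResolutionOfSingularities
import Mathlib.FieldTheory.PrimitiveElement
import Mathlib.AlgebraicGeometry.Morphisms.Smooth

/-!
# `WeightedInvariant.WeightedThesis`, line `datum-glued-split`, RESHAPE 4, stub M (finite fields)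

Crux `WeightedThesis` (stmt-ResolutionOfSingularities-0569), lead a1, 2026-08-17: the glue
`stub_finiteFieldBranch_of_parts`. From (A) a finite separable `ψ : X → ℙ^d_k`, `d = dim X`,
(B) graph closures of transcendental rational functions, (C) local principality of images of
finite morphisms from integral `d`-folds into smooth `(d+1)`-folds: an integral closed `X ⊆ ℙⁿ_k`
is regular (`d = 0`) or has `X ← X' → H ⊆ ℙ^d ×_k ℙ¹` (`X' → X` proper birational, `X' → H` finite
birational, `H` locally principal) — `X'` the closure of the graph of a primitive element `w` of
`K(X)/K(ℙ^d)`, `Φ = (ψρ, w)`. [Fulton 1998, Prop. 1.4 (a) (proof); Hartshorne I Prop. 4.9]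
-/

noncomputable section

set_option linter.dupNamespace false -- mandated namespace of this single-conjunct summit

open CategoryTheory CategoryTheory.Limits AlgebraicGeometry TopologicalSpace Topology Order
open Literature.AlgebraicGeometry.Resolution Literature.AlgebraicGeometry.Motives
open Literature.AlgebraicGeometry.Motives.Segre (toSpec)

namespace Summit.ResolutionOfSingularities.ResolutionOfSingularities.Theorems.WeightedThesis.HypersurfaceModel

universe u

/-- An integral scheme of topological Krull dimension `0` has only its generic point.
[folklore] -/
theorem eq_genericPoint_of_topologicalKrullDim_eq_zero {X : Scheme.{u}} [IsIntegral X]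
    (h : topologicalKrullDim X = 0) (x : X) : x = genericPoint X := by
  by_contra hx
  -- `closure {x} < univ` is a chain of irreducible closed subsets of length one
  have hlt : (⟨closure {x}, isIrreducible_singleton.closure, isClosed_closure⟩ :
      IrreducibleCloseds X) < ⟨Set.univ, IrreducibleSpace.isIrreducible_univ X, isClosed_univ⟩ := by
    refine lt_of_le_of_ne (fun _ _ => Set.mem_univ _) fun heq => hx ?_
    have hcl : closure ({x} : Set X) = Set.univ := congrArg (fun Z : IrreducibleCloseds X => (Z : Set X)) heq
    exact IsGenericPoint.eq (show IsGenericPoint x Set.univ from hcl) (genericPoint_spec X)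
  have h1 : 1 ≤ topologicalKrullDim X := by
    unfold topologicalKrullDim
    exact Order.one_le_krullDim_iff.2 ⟨_, _, hlt⟩
  rw [h] at h1
  exact absurd h1 (by norm_num)

/-- **An integral scheme of dimension zero is regular**: its only point is the generic point,
whose local ring is the function field. [folklore] -/
theorem isRegular_of_topologicalKrullDim_eq_zero {X : Scheme.{u}} [IsIntegral X]
    (h : topologicalKrullDim X = 0) : Scheme.IsRegular X := by
  intro x
  obtain rfl := eq_genericPoint_of_topologicalKrullDim_eq_zero h x
  change IsRegularLocalRing X.functionField
  infer_instance

/-- If `K/F` is finite separable and `z ∈ F` is transcendental over `k`, then `K = F(w)` with `w`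
transcendental over `k` (a primitive element `w₀`, or `w₀ + z`). [folklore] -/
theorem exists_transcendental_adjoin_eq_top {k F K : Type*} [Field k] [Field F] [Field K]
    [Algebra k F] [Algebra F K] [Algebra k K] [IsScalarTower k F K] [FiniteDimensional F K]
    [Algebra.IsSeparable F K] (z : F) (hz : Transcendental k z) :
    ∃ w : K, Transcendental k w ∧ IntermediateField.adjoin F {w} = ⊤ := by
  obtain ⟨w₀, hw₀⟩ := Field.exists_primitive_element F K
  by_cases hw : Transcendental k w₀
  · exact ⟨w₀, hw, hw₀⟩
  · rw [Transcendental, not_not] at hw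
    refine ⟨w₀ + algebraMap F K z, fun halg => hz ?_, ?_⟩
    · have h1 : IsAlgebraic k (algebraMap F K z) := by
        simpa using halg.sub hw
      exact (isAlgebraic_algebraMap_iff (FaithfulSMul.algebraMap_injective F K)).1 h1
    · rw [← hw₀]
      apply le_antisymm
      · rw [IntermediateField.adjoin_simple_le_iff]
        have h1 : w₀ + algebraMap F K z - algebraMap F K z ∈ IntermediateField.adjoin F {w₀} := by
          rw [add_sub_cancel_right]; exact IntermediateField.mem_adjoin_simple_self F w₀
        have h2 := add_mem h1 (algebraMap_mem (IntermediateField.adjoin F {w₀}) z)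
        rwa [sub_add_cancel] at h2
      · rw [IntermediateField.adjoin_simple_le_iff]
        have h1 := sub_mem (IntermediateField.mem_adjoin_simple_self F (w₀ + algebraMap F K z))
          (algebraMap_mem (IntermediateField.adjoin F {w₀ + algebraMap F K z}) z)
        rwa [add_sub_cancel_right] at h1

/-- For an integral scheme, `topologicalKrullDim X = height ⊤` (`⊤` = generic point). [folklore] -/
theorem topologicalKrullDim_eq_height_top (Y : Scheme.{u}) [IsIntegral Y] :
    topologicalKrullDim Y = height (⊤ : Y) := by
  -- adapted from Literature/AlgebraicGeometry/Motives/LinesGenerateChowOneSumSq.lean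
  rw [show topologicalKrullDim Y = krullDim Y from
    Order.krullDim_eq_of_orderIso (irreducibleSetEquivPoints (α := Y))]
  exact (Order.height_top_eq_krullDim (α := Y)).symm

/-- `height ⊤ = d` from `topologicalKrullDim = d`. [folklore] -/
theorem height_top_eq_of_topologicalKrullDim_eq {Y : Scheme.{u}} [IsIntegral Y] {d : ℕ}
    (h : topologicalKrullDim Y = d) : height (⊤ : Y) = d := by
  rw [topologicalKrullDim_eq_height_top] at h
  have h' : ((height (⊤ : Y) : ℕ∞) : WithBot ℕ∞) = ((d : ℕ∞) : WithBot ℕ∞) := h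
  exact_mod_cast h'

/-- `topologicalKrullDim = d` from `height ⊤ = d`. [folklore] -/
theorem topologicalKrullDim_eq_of_height_top_eq {Y : Scheme.{u}} [IsIntegral Y] {d : ℕ}
    (h : height (⊤ : Y) = d) : topologicalKrullDim Y = d := by
  rw [topologicalKrullDim_eq_height_top, h]; rfl

variable (k : Type u) [Field k]

/-- **Birational invariance of dimension** (dominant `k`-morphism, bijective on function fields;
both dimensions are the transcendence degree, `height_top_eq_of_algEquiv`). [folklore] -/
theorem topologicalKrullDim_eq_of_functionFieldMap_bijective {X X' : Scheme.{u}} [IsIntegral X]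
    [IsIntegral X'] (fX : X ⟶ Spec (.of k)) [LocallyOfFiniteType fX] (π : X' ⟶ X) [IsDominant π]
    [LocallyOfFiniteType (π ≫ fX)] (hπ : Function.Bijective (RatFn.functionFieldMap π)) :
    topologicalKrullDim X' = topologicalKrullDim X := by
  letI algX := ((X.presheaf.germ ⊤ (genericPoint X) trivial).hom.comp
    (fX.appTop.hom.comp (Scheme.ΓSpecIso (.of k)).inv.hom)).toAlgebra
  letI algX' := ((X'.presheaf.germ ⊤ (genericPoint X') trivial).hom.comp
    ((π ≫ fX).appTop.hom.comp (Scheme.ΓSpecIso (.of k)).inv.hom)).toAlgebra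
  let e : X.functionField ≃ₐ[k] X'.functionField :=
    { RingEquiv.ofBijective (RatFn.functionFieldMap π) hπ with
      commutes' := fun c => functionFieldMap_algebraMap_top fX π (π ≫ fX) rfl c }
  rw [topologicalKrullDim_eq_height_top, topologicalKrullDim_eq_height_top,
    height_top_eq_of_algEquiv fX (π ≫ fX) e]

/-- `K(ℙ^d)` has an element transcendental over `k` when `d ≥ 1` (`trdeg = dim = d`). [folklore] -/
theorem exists_transcendental_functionField_projectiveSpace (d : ℕ) (hd : d ≠ 0) :
    letI := (((ProjSpace.P d k).presheaf.germ ⊤ (genericPoint (ProjSpace.P d k)) trivial).hom.comp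
      ((toSpec (Fin (d + 1)) k).appTop.hom.comp (Scheme.ΓSpecIso (.of k)).inv.hom)).toAlgebra
    ∃ z : (ProjSpace.P d k).functionField, Transcendental k z := by
  letI alg := (((ProjSpace.P d k).presheaf.germ ⊤ (genericPoint (ProjSpace.P d k)) trivial).hom.comp
      ((toSpec (Fin (d + 1)) k).appTop.hom.comp (Scheme.ΓSpecIso (.of k)).inv.hom)).toAlgebra
  haveI : IsProper (toSpec (Fin (d + 1)) k) := ProjSpace.isProper_over d k
  have hh : height (⊤ : ProjSpace.P d k) = d :=
    height_top_eq_of_topologicalKrullDim_eq (ProjSpace.topologicalKrullDim_eq d k)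
  have htr := height_top_eq_trdeg (toSpec (Fin (d + 1)) k)
  rw [hh] at htr
  have hnat : Cardinal.toNat (Algebra.trdeg k (ProjSpace.P d k).functionField) = d := by
    have h' : ((d : ℕ∞) : WithBot ℕ∞) =
        ((Cardinal.toNat (Algebra.trdeg k (ProjSpace.P d k).functionField) : ℕ∞) : WithBot ℕ∞) := htr
    exact_mod_cast h'.symm
  have hne : Algebra.trdeg k (ProjSpace.P d k).functionField ≠ 0 := by
    intro h0; rw [h0] at hnat; simp at hnat; exact hd hnat.symm
  exact (trdeg_ne_zero_iff.1 hne).transcendental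

/-- The standing instances on `ℙ^d`, `ℙ¹` and `ℙ^d ×_k ℙ¹`: properness of the structure maps,
local Noetherianity of `ℙ^d`, geometric integrality of `ℙ¹ → Spec k`
(`ProjLine.geometricallyIntegral_toSpec`), integrality of the product. [folklore] -/
theorem prod_instances (d : ℕ) :
    IsProper (toSpec (Fin (d + 1)) k) ∧ IsProper (toSpec (Fin (1 + 1)) k) ∧
      IsLocallyNoetherian (ProjSpace.P d k) ∧ GeometricallyIntegral (toSpec (Fin (1 + 1)) k) ∧
      IsIntegral (pullback (toSpec (Fin (d + 1)) k) (toSpec (Fin (1 + 1)) k)) := by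
  haveI : IsProper (toSpec (Fin (d + 1)) k) := ProjSpace.isProper_over d k
  haveI : IsProper (toSpec (Fin (1 + 1)) k) := ProjSpace.isProper_over 1 k
  haveI : IsLocallyNoetherian (ProjSpace.P d k) :=
    LocallyOfFiniteType.isLocallyNoetherian (toSpec (Fin (d + 1)) k)
  haveI : GeometricallyIntegral (toSpec (Fin (1 + 1)) k) := ProjLine.geometricallyIntegral_toSpec k
  exact ⟨inferInstance, inferInstance, inferInstance, inferInstance, inferInstance⟩

/-- `ℙ^d ×_k ℙ¹ → Spec k` (through the first projection) is smooth, separated and proper.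
[folklore] -/
theorem smooth_isSeparated_isProper_prodToSpec (d : ℕ) :
    Smooth (pullback.fst (toSpec (Fin (d + 1)) k) (toSpec (Fin (1 + 1)) k) ≫ toSpec (Fin (d + 1)) k) ∧
      IsSeparated (pullback.fst (toSpec (Fin (d + 1)) k) (toSpec (Fin (1 + 1)) k) ≫ toSpec (Fin (d + 1)) k) ∧
      IsProper (pullback.fst (toSpec (Fin (d + 1)) k) (toSpec (Fin (1 + 1)) k) ≫ toSpec (Fin (d + 1)) k) := by
  obtain ⟨h1, h2, h3⟩ := smooth_isSeparated_isProper_toSpec k d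
  obtain ⟨h1', h2', h3'⟩ := smooth_isSeparated_isProper_toSpec k 1
  haveI := h1; haveI := h2; haveI := h3; haveI := h1'; haveI := h2'; haveI := h3'
  exact ⟨inferInstance, inferInstance, inferInstance⟩

/-- `dim (ℙ^d ×_k ℙ¹) = d + 1` (`height_top_pullback_eq_add_one`, chart `Spec k[T] ↪ ℙ¹`). [folklore] -/
theorem topologicalKrullDim_prodSpace (d : ℕ) :
    topologicalKrullDim (pullback (toSpec (Fin (d + 1)) k) (toSpec (Fin (1 + 1)) k) : Scheme.{u}) =
      (d + 1 : ℕ) := by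
  obtain ⟨_, _, _, _, _⟩ := prod_instances k d
  have h := height_top_pullback_eq_add_one (toSpec (Fin (1 + 1)) k) (ProjLine.jT k)
    (ProjLine.jT_toSpec k) (toSpec (Fin (d + 1)) k) d
    (height_top_eq_of_topologicalKrullDim_eq (ProjSpace.topologicalKrullDim_eq d k))
  exact topologicalKrullDim_eq_of_height_top_eq (by exact_mod_cast h)

/-- **Hypersurface models in `ℙ^d ×_k ℙ¹`**: for `X'` integral of dimension `d` and
`Φ : X' → ℙ^d ×_k ℙ¹` finite with surjective stalk map at the generic point — granting stub C —
the scheme-theoretic image `H` is integral with locally principal ideal in the smooth separated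
quasi-compact `ℙ^d ×_k ℙ¹`, and `Φ : X' → H` is finite birational
(`isBirational_of_surjective_stalkMap`). [folklore; cite: Hartshorne1977, I Prop. 4.9] -/
theorem productModel_of_imageLocallyPrincipal
    (hC : ∀ (k : Type u) [Field k] (X' Y : Scheme.{u}) [IsIntegral X'] [IsIntegral Y]
      (gY : Y ⟶ Spec (.of k)) [Smooth gY] (Φ : X' ⟶ Y) [IsFinite Φ] (d : ℕ),
      topologicalKrullDim X' = d → topologicalKrullDim Y = (d + 1 : ℕ) →
      ∀ y : Y, ∃ U : Y.affineOpens, y ∈ (U : Y.Opens) ∧ (Φ.ker.ideal U).IsPrincipal)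
    (d : ℕ) {X' : Scheme.{u}} [IsIntegral X'] (Φ : X' ⟶ pullback (toSpec (Fin (d + 1)) k) (toSpec (Fin (1 + 1)) k))
    [IsFinite Φ]
    (hdim : topologicalKrullDim X' = d)
    (hgen : Function.Surjective (Φ.stalkMap (genericPoint X'))) :
    ∃ (Y H : Scheme.{u}) (g : Y ⟶ Spec (.of k)) (j : H ⟶ Y) (φ : X' ⟶ H),
      Smooth g ∧ IsSeparated g ∧ QuasiCompact g ∧ IsClosedImmersion j ∧ IsIntegral H ∧
      (∀ y : Y, ∃ U : Y.affineOpens, y ∈ (U : Y.Opens) ∧ (j.ker.ideal U).IsPrincipal) ∧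
      IsFinite φ ∧ IsBirational φ := by
  obtain ⟨hsm, hsep, hpr⟩ := smooth_isSeparated_isProper_prodToSpec k d
  obtain ⟨_, _, _, _, _⟩ := prod_instances k d
  haveI := hsm; haveI := hsep; haveI := hpr
  haveI : IsIntegral Φ.image := ChowLemmaProof.isIntegral_image Φ
  refine ⟨_, Φ.image, _, Φ.imageι, Φ.toImage, hsm, hsep, inferInstance, inferInstance,
    inferInstance, ?_, ?_, ?_⟩
  · intro y
    rw [Scheme.IdealSheafData.ker_subschemeι]
    exact hC k X' (pullback (toSpec (Fin (d + 1)) k) (toSpec (Fin (1 + 1)) k))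
      (pullback.fst (toSpec (Fin (d + 1)) k) (toSpec (Fin (1 + 1)) k) ≫ toSpec (Fin (d + 1)) k) Φ d
      hdim (topologicalKrullDim_prodSpace k d) y
  · haveI : IsFinite (Φ.toImage ≫ Φ.imageι) := by rw [Φ.toImage_imageι]; infer_instance
    exact IsFinite.of_comp Φ.toImage Φ.imageι
  · have h2 : Function.Surjective ((Φ.toImage ≫ Φ.imageι).stalkMap (genericPoint X')) := by
      rw [Φ.toImage_imageι]; exact hgen
    rw [Scheme.Hom.stalkMap_comp] at h2
    haveI : IsFinite (Φ.toImage ≫ Φ.imageι) := by rw [Φ.toImage_imageι]; infer_instance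
    haveI : IsFinite Φ.toImage := IsFinite.of_comp Φ.toImage Φ.imageι
    exact isBirational_of_surjective_stalkMap Φ.toImage
      (Φ.imageι ≫ (pullback.fst (toSpec (Fin (d + 1)) k) (toSpec (Fin (1 + 1)) k) ≫ toSpec (Fin (d + 1)) k))
      (Function.Surjective.of_comp h2)

/-- `f^♯_x(a)` lies in the range of the stalk map of `Φ` at `x` whenever `f = Φ ≫ q`. [folklore] -/
theorem stalkMap_mem_range_of_comp_eq {X' Y Z : Scheme.{u}} (Φ : X' ⟶ Y) (q : Y ⟶ Z)
    (f : X' ⟶ Z) (h : f = Φ ≫ q) (x : X') (a : Z.presheaf.stalk (f x)) :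
    (f.stalkMap x).hom a ∈ Set.range (Φ.stalkMap x).hom := by
  rw [Scheme.Hom.stalkMap_congr_hom f (Φ ≫ q) h x, Scheme.Hom.stalkMap_comp]
  exact ⟨_, rfl⟩

/-- For a dominant `f = Φ ≫ q`, `f^♯(K(Z))` lies in the range of the stalk map of `Φ` at `η`. [folklore] -/
theorem functionFieldMap_mem_range_of_comp_eq {X' Y Z : Scheme.{u}} [IsIntegral X']
    [IsIntegral Z] (Φ : X' ⟶ Y) (q : Y ⟶ Z) (f : X' ⟶ Z) [IsDominant f] (h : f = Φ ≫ q)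
    (a : Z.functionField) :
    RatFn.functionFieldMap f a ∈ Set.range (Φ.stalkMap (genericPoint X')).hom :=
  stalkMap_mem_range_of_comp_eq Φ q f h (genericPoint X') _

/-- **Stub M (registered glue): the finite-field branch from stubs A, B, C.** For an integral
closed `X ⊆ ℙⁿ_k`, `k` perfect of characteristic `p`: `X` is regular, or some proper birational
`ρ : X' → X` (integral `X'`) and finite birational `φ : X' → H` onto an integral closed `H`, with
locally principal ideal, of a smooth separated quasi-compact `k`-scheme `Y` exist. `d = 0`: `X` is
a point. `d ≥ 1`: primitive element `w` of the finite separable `K(X)/K(ℙ^d)`, transcendental over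
`k`; `X'` the closure of its graph; `Φ = (ψρ, w) : X' → ℙ^d ×_k ℙ¹` is finite (`X' ↪ X ×_k ℙ¹`
closed, `ψ × 𝟙` finite) with surjective stalk map at `η` (`K(X') = ρ^♯K(X)` is generated by
`ρ^♯ψ^♯K(ℙ^d)` and `ρ^♯w = w^♯t`). [folklore; cite: Fulton1998, Prop. 1.4 (a) (proof); Hartshorne1977, I Prop. 4.9] -/
theorem stub_finiteFieldBranch_of_parts :
    (∀ (p : ℕ), p.Prime → ∀ (k : Type) [Field k] [CharP k p] [PerfectField k] (n : ℕ)
      (X : AlgebraicGeometry.Scheme.{0}) [AlgebraicGeometry.IsIntegral X]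
      (ι : X ⟶ (Literature.AlgebraicGeometry.Motives.projectiveSpace n k).left)
      [AlgebraicGeometry.IsClosedImmersion ι],
      ∃ (d : ℕ) (ψ : X ⟶ Literature.AlgebraicGeometry.Motives.ProjSpace.P d k)
        (_ : AlgebraicGeometry.IsFinite ψ) (_ : AlgebraicGeometry.Surjective ψ),
        ψ ≫ Literature.AlgebraicGeometry.Motives.Segre.toSpec (Fin (d + 1)) k =
            ι ≫ (Literature.AlgebraicGeometry.Motives.projectiveSpace n k).hom ∧
        topologicalKrullDim X = d ∧
        ∀ [Algebra (Literature.AlgebraicGeometry.Motives.ProjSpace.P d k).functionField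
            X.functionField],
          algebraMap (Literature.AlgebraicGeometry.Motives.ProjSpace.P d k).functionField
              X.functionField = Literature.AlgebraicGeometry.Motives.RatFn.functionFieldMap ψ →
          Algebra.IsSeparable (Literature.AlgebraicGeometry.Motives.ProjSpace.P d k).functionField
              X.functionField ∧
            Module.Finite (Literature.AlgebraicGeometry.Motives.ProjSpace.P d k).functionField
              X.functionField) →
    (∀ (k : Type) [Field k] (X : AlgebraicGeometry.Scheme.{0}) [AlgebraicGeometry.IsIntegral X]
      [AlgebraicGeometry.IsLocallyNoetherian X] (fX : X ⟶ AlgebraicGeometry.Spec (.of k))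
      (w : X.functionField),
      (letI := ((X.presheaf.germ ⊤ (genericPoint X) trivial).hom.comp
          (fX.appTop.hom.comp (AlgebraicGeometry.Scheme.ΓSpecIso (.of k)).inv.hom)).toAlgebra;
        Transcendental k w) →
      ∃ (X' : AlgebraicGeometry.Scheme.{0}) (_ : AlgebraicGeometry.IsIntegral X') (π : X' ⟶ X)
        (_ : AlgebraicGeometry.IsProper π) (_ : AlgebraicGeometry.IsDominant π)
        (ψ : X' ⟶ Literature.AlgebraicGeometry.Motives.ProjSpace.P 1 k)
        (_ : AlgebraicGeometry.IsDominant ψ)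
        (hc : π ≫ fX = ψ ≫ Literature.AlgebraicGeometry.Motives.Segre.toSpec (Fin (1 + 1)) k),
        Literature.AlgebraicGeometry.Resolution.IsBirational π ∧
        AlgebraicGeometry.IsClosedImmersion (CategoryTheory.Limits.pullback.lift π ψ hc) ∧
        Function.Bijective (Literature.AlgebraicGeometry.Motives.RatFn.functionFieldMap π) ∧
        Literature.AlgebraicGeometry.Motives.RatFn.functionFieldMap ψ
            (Literature.AlgebraicGeometry.Motives.ProjLine.t k) =
          Literature.AlgebraicGeometry.Motives.RatFn.functionFieldMap π w) →
    (∀ (k : Type) [Field k] (X' Y : AlgebraicGeometry.Scheme.{0}) [AlgebraicGeometry.IsIntegral X']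
      [AlgebraicGeometry.IsIntegral Y] (gY : Y ⟶ AlgebraicGeometry.Spec (.of k))
      [AlgebraicGeometry.Smooth gY] (Φ : X' ⟶ Y) [AlgebraicGeometry.IsFinite Φ] (d : ℕ),
      topologicalKrullDim X' = d → topologicalKrullDim Y = (d + 1 : ℕ) →
      ∀ y : Y, ∃ U : Y.affineOpens, y ∈ (U : Y.Opens) ∧ (Φ.ker.ideal U).IsPrincipal) →
    ∀ (p : ℕ), p.Prime → ∀ (k : Type) [Field k] [CharP k p] [PerfectField k] (n : ℕ)
      (X : AlgebraicGeometry.Scheme.{0})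
      (ι : X ⟶ (Literature.AlgebraicGeometry.Motives.projectiveSpace n k).left),
      AlgebraicGeometry.IsClosedImmersion ι → AlgebraicGeometry.IsIntegral X →
      Literature.AlgebraicGeometry.Resolution.Scheme.IsRegular X ∨
      ∃ (X' : AlgebraicGeometry.Scheme.{0}) (_ : AlgebraicGeometry.IsIntegral X') (ρ : X' ⟶ X)
        (_ : AlgebraicGeometry.IsProper ρ),
        Literature.AlgebraicGeometry.Resolution.IsBirational ρ ∧
        ∃ (Y H : AlgebraicGeometry.Scheme.{0}) (g : Y ⟶ AlgebraicGeometry.Spec (.of k)) (j : H ⟶ Y)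
          (φ : X' ⟶ H), AlgebraicGeometry.Smooth g ∧ AlgebraicGeometry.IsSeparated g ∧
          AlgebraicGeometry.QuasiCompact g ∧ AlgebraicGeometry.IsClosedImmersion j ∧
          AlgebraicGeometry.IsIntegral H ∧
          (∀ y : Y, ∃ U : Y.affineOpens, y ∈ (U : Y.Opens) ∧ (j.ker.ideal U).IsPrincipal) ∧
          AlgebraicGeometry.IsFinite φ ∧ Literature.AlgebraicGeometry.Resolution.IsBirational φ := by
  intro hA hB hC p hp k _ _ _ n X ι hι hX
  haveI := hι; haveI := hX
  obtain ⟨d, ψ, hfin, hsurjψ, hψ, hdim, hsep⟩ := hA p hp k n X ι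
  rcases Nat.eq_zero_or_pos d with rfl | hd
  · exact Or.inl (isRegular_of_topologicalKrullDim_eq_zero (by rw [hdim]; rfl))
  right
  -- notation, instances and algebra structures
  obtain ⟨_, _, _, _, _⟩ := prod_instances k d
  haveI : IsProper (toSpec (Fin (n + 1)) k) := ProjSpace.isProper_over n k
  set fX : X ⟶ Spec (.of k) := ι ≫ (projectiveSpace n k).hom with hfX
  haveI : LocallyOfFiniteType fX := by rw [hfX]; exact inferInstance
  have hψ' : ψ ≫ toSpec (Fin (d + 1)) k = fX := hψ
  letI algFK : Algebra (ProjSpace.P d k).functionField X.functionField :=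
    (RatFn.functionFieldMap ψ).toAlgebra
  obtain ⟨hsepK, hfinK⟩ := hsep rfl
  letI algkF : Algebra k (ProjSpace.P d k).functionField :=
    (((ProjSpace.P d k).presheaf.germ ⊤ (genericPoint (ProjSpace.P d k)) trivial).hom.comp
      ((toSpec (Fin (d + 1)) k).appTop.hom.comp (Scheme.ΓSpecIso (.of k)).inv.hom)).toAlgebra
  letI algkK : Algebra k X.functionField :=
    ((X.presheaf.germ ⊤ (genericPoint X) trivial).hom.comp
      (fX.appTop.hom.comp (Scheme.ΓSpecIso (.of k)).inv.hom)).toAlgebra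
  haveI : IsScalarTower k (ProjSpace.P d k).functionField X.functionField :=
    IsScalarTower.of_algebraMap_eq fun c =>
      (functionFieldMap_algebraMap_top (toSpec (Fin (d + 1)) k) ψ fX hψ' c).symm
  -- a primitive element transcendental over `k`
  obtain ⟨z, hz⟩ := exists_transcendental_functionField_projectiveSpace k d hd.ne'
  obtain ⟨w, hwtr, hwgen⟩ := exists_transcendental_adjoin_eq_top
    (k := k) (F := (ProjSpace.P d k).functionField) (K := X.functionField) z hz
  -- the closure of the graph of `w`
  haveI : IsLocallyNoetherian X := LocallyOfFiniteType.isLocallyNoetherian fX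
  obtain ⟨X', hX', π, hπp, hπd, ψ₁, hψ₁d, hc, hbir, hclosed, hbij, ht⟩ := hB k X fX w hwtr
  -- `Φ = (ψπ, ψ₁) : X' → ℙ^d ×_k ℙ¹`, finite
  have e₁ : fX = ψ ≫ toSpec (Fin (d + 1)) k := hψ'.symm
  have e₂ : toSpec (Fin (1 + 1)) k = 𝟙 _ ≫ toSpec (Fin (1 + 1)) k := (Category.id_comp _).symm
  have hm := MorphismProperty.pullbackMap (P := @IsFinite) (f := fX) (g := toSpec (Fin (1 + 1)) k)
    (f' := toSpec (Fin (d + 1)) k) (g' := toSpec (Fin (1 + 1)) k) (i₁ := ψ) (i₂ := 𝟙 _)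
    hfin inferInstance e₁ e₂
  set m := pullback.map fX (toSpec (Fin (1 + 1)) k) (toSpec (Fin (d + 1)) k)
    (toSpec (Fin (1 + 1)) k) ψ (𝟙 _) (𝟙 _) ((Category.comp_id _).trans e₁)
    ((Category.comp_id _).trans e₂) with hmdef
  haveI : IsFinite m := hm
  haveI := hclosed
  set Φ : X' ⟶ pullback (toSpec (Fin (d + 1)) k) (toSpec (Fin (1 + 1)) k) :=
    pullback.lift π ψ₁ hc ≫ m with hΦdef
  haveI : IsFinite Φ := inferInstance
  have hΦfst : Φ ≫ pullback.fst _ _ = π ≫ ψ := by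
    simp only [hΦdef, hmdef, Category.assoc, pullback.lift_fst, pullback.lift_fst_assoc]
  have hΦsnd : Φ ≫ pullback.snd _ _ = ψ₁ := by
    simp only [hΦdef, hmdef, Category.assoc, pullback.lift_snd, Category.comp_id]
  -- `dim X' = d`
  have hdimX' : topologicalKrullDim X' = d := by
    rw [topologicalKrullDim_eq_of_functionFieldMap_bijective k fX π hbij]; exact hdim
  -- the stalk map of `Φ` at the generic point is surjective
  have hgen : Function.Surjective (Φ.stalkMap (genericPoint X')) := by
    let S : Subfield X'.functionField :=
      { (Φ.stalkMap (genericPoint X')).hom.range with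
        inv_mem' := fun r hr => by
          have hr' : r ∈ Set.range (Φ.stalkMap (genericPoint X')).hom := by
            obtain ⟨a, ha⟩ := hr; exact ⟨a, ha⟩
          obtain ⟨b, hb⟩ := inv_mem_range_stalkMap Φ hr'
          exact ⟨b, hb⟩ }
    have hS : ∀ {r}, r ∈ Set.range (Φ.stalkMap (genericPoint X')).hom → r ∈ S :=
      fun ⟨a, ha⟩ => ⟨a, ha⟩
    haveI : IsDominant (π ≫ ψ) := inferInstance
    have key1 : ∀ a, RatFn.functionFieldMap (π ≫ ψ) a ∈ S := fun a =>
      hS (functionFieldMap_mem_range_of_comp_eq Φ (pullback.fst _ _) (π ≫ ψ) hΦfst.symm a)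
    have key2 : RatFn.functionFieldMap π w ∈ S := by
      rw [← ht]
      exact hS (functionFieldMap_mem_range_of_comp_eq Φ (pullback.snd _ _) ψ₁ hΦsnd.symm _)
    have htop : Subfield.closure (Set.range (algebraMap (ProjSpace.P d k).functionField
        X.functionField) ∪ {w}) = ⊤ := by
      rw [← IntermediateField.adjoin_toSubfield, hwgen, IntermediateField.top_toSubfield]
    have hle : Subfield.closure (RatFn.functionFieldMap π ''
        (Set.range (algebraMap (ProjSpace.P d k).functionField X.functionField) ∪ {w})) ≤ S := by
      rw [Subfield.closure_le]
      rintro _ ⟨x, hx, rfl⟩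
      rcases hx with ⟨a, rfl⟩ | hx
      · have : RatFn.functionFieldMap π (algebraMap _ X.functionField a) =
            RatFn.functionFieldMap (π ≫ ψ) a := by
          rw [RatFn.functionFieldMap_comp]; rfl
        rw [this]; exact key1 a
      · rw [Set.mem_singleton_iff.1 hx]; exact key2
    intro r
    obtain ⟨r₀, rfl⟩ := hbij.2 r
    have hr₀ : r₀ ∈ Subfield.closure (Set.range (algebraMap (ProjSpace.P d k).functionField
        X.functionField) ∪ {w}) := by rw [htop]; exact Subfield.mem_top r₀
    have h1 : RatFn.functionFieldMap π r₀ ∈ (Subfield.closure (Set.range (algebraMap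
        (ProjSpace.P d k).functionField X.functionField) ∪ {w})).map (RatFn.functionFieldMap π) :=
      Subfield.mem_map.2 ⟨r₀, hr₀, rfl⟩
    rw [RingHom.map_field_closure] at h1
    obtain ⟨b, hb⟩ := hle h1
    exact ⟨b, hb⟩
  -- assemble
  obtain ⟨Y, H, g, j, φ, h1, h2, h3, h4, h5, h6, h7, h8⟩ :=
    productModel_of_imageLocallyPrincipal k hC d Φ hdimX' hgen
  exact ⟨X', hX', π, hπp, hbir, Y, H, g, j, φ, h1, h2, h3, h4, h5, h6, h7, h8⟩

end Summit.ResolutionOfSingularities.ResolutionOfSingularities.Theorems.WeightedThesis.HypersurfaceModel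

end
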